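import Literature.Analysis.FluidPDE.CompressibleEulerImplosionRatesFromFacts
import Literature.Analysis.FluidPDE.CompressibleEulerImplosionRatesProofs
import Literature.Analysis.FluidPDE.CompressibleEulerImplosionShooting
import Literature.Analysis.FluidPDE.CompressibleEulerImplosionLeftAssembly
import HarnessLib

/-!
# The blow-up rates of periodic implosion (Cao-Labora–Gómez-Serrano–Shi–Staffilani 2025, Thm 1.2 /
# Rem. 1.5, `γ = 5/3`) from the certified left-barrier data of Buckmaster–Cao-Labora–Gómez-Serrano

Analysis/FluidPDE proof file (theorems only; no definitions, no named facts). It joins the two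
programmes of the tree that bear on the named fact
`Literature.Analysis.FluidPDE.CaolaboraEtAl2025_thm12_rates` (`CompressibleEulerImplosionRates.lean`):

* `CompressibleEulerImplosionRatesFromFacts.lean`:
  `CaolaboraEtAl2025.rates_of_thm11_monatomic : X → CaolaboraEtAl2025_thm12_rates`, where
  `X = BuckmasterCaolaboraGomezserrano2025_thm11_monatomic` is the smooth self-similar profile of the
  monatomic gas (Buckmaster–Cao-Labora–Gómez-Serrano 2025, Thm 1.1 at `γ = 5/3`) — the whole
  finite-speed-of-propagation construction of CGSS Rem. 1.5 with the local existence input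
  discharged;
* `CompressibleEulerImplosionShooting.lean`:
  `BuckmasterCaolaboraGomezserrano2025.Monatomic.Shooting.thm11_monatomic_of_left`, Theorem 1.1 at
  `γ = 5/3` from Proposition 3.1 of the paper on the certified shooting window `[r_d, r_u]`
  (the right barriers, the sign change `e(r_u) < 0 < e(r_d)` and the continuity of `e` are all
  proved there), and `CompressibleEulerImplosionLeftAssembly.lean`:
  `…Monatomic.LeftAsm.leftData_of_hyp`, Proposition 3.1 at a given `r` from the certified
  near/far left-barrier data `LeftAsm.LeftHyp r` (Props. 3.3, 3.5 of the paper).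

Consequently the rates fact — and with it the instance `CaolaboraEtAl2025_thm12_euler (5/3)` of the
`γ`-parametrised sibling fact (`CaolaboraEtAl2025.thm12_euler_of_rates`,
`CompressibleEulerImplosionRatesProofs.lean`) — is reduced to exactly one remaining obligation of
the Buckmaster–Cao-Labora–Gómez-Serrano programme, Proposition 3.1 on the window, in either of its
two tree forms: the conclusion `∀ r ∈ [r_d, r_u], LeftAsm.LeftData r` (`rates_of_leftData`) or the
certificate layer `∀ r ∈ [r_d, r_u], LeftAsm.LeftHyp r` (`rates_of_leftHyp`). The discharge
`CaolaboraEtAl2025_thm12_rates_holds` is then the term `rates_of_leftHyp H` (or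
`rates_of_thm11_monatomic X_holds`) as soon as that layer (or `X_holds`) lands.

## References

* G. Cao-Labora, J. Gómez-Serrano, J. Shi, G. Staffilani, *Non-radial implosion for compressible
  Euler and Navier–Stokes in `𝕋³` and `ℝ³`*, Camb. J. Math. 13 (2025), arXiv:2310.05325, Thm 1.2
  p. 6, Rem. 1.4 p. 6, Rem. 1.5 p. 7. [`CaolaboraEtAl2025`]
* T. Buckmaster, G. Cao-Labora, J. Gómez-Serrano, *Smooth imploding solutions for 3D compressible
  fluids*, Forum Math. Pi 13 (2025) e6, arXiv:2208.09445, Thm 1.1, Prop. 3.1, Props. 3.3, 3.5,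
  Prop. 4.1, §6. [`BuckmasterCaolaboraGomezserrano2025`]
-/

noncomputable section

open Set

namespace Literature.Analysis.FluidPDE

namespace CaolaboraEtAl2025

open BuckmasterCaolaboraGomezserrano2025.Monatomic

/-- **The rates fact from Proposition 3.1 on the shooting window.** If for every `r ∈ [r_d, r_u]`
the smooth branch through `P_s` continues to the left as a solution of the autonomous system off
the sonic lines with `Z < W`, tending to `P_∞ = (0,0)` (`LeftAsm.LeftData r`, Prop. 3.1 of
Buckmaster–Cao-Labora–Gómez-Serrano), then `CaolaboraEtAl2025_thm12_rates` holds: the profile fact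
follows by `Shooting.thm11_monatomic_of_left`, and the rates by `rates_of_thm11_monatomic`.
[cite: CaolaboraEtAl2025, Thm 1.2, Rem. 1.5]
[cite: BuckmasterCaolaboraGomezserrano2025, Thm 1.1, Prop. 3.1, §6] -/
theorem rates_of_leftData (h : ∀ r ∈ Icc Shooting.rd Shooting.ru, LeftAsm.LeftData r) :
    CaolaboraEtAl2025_thm12_rates :=
  rates_of_thm11_monatomic (Shooting.thm11_monatomic_of_left fun r hr => by
    obtain ⟨Wl, Zl, δ, hδ, hgerm, hode, hoff, hW, hZ⟩ := h r hr
    exact ⟨Wl, Zl, δ, hδ, hgerm, hode, hoff, hW, hZ⟩)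

/-- **The rates fact from the certified left-barrier layer.** If for every `r ∈ [r_d, r_u]` the
near (quartic) and far (`C¹`) left barriers of Props. 3.3/3.5 are certified (`LeftAsm.LeftHyp r`),
then `CaolaboraEtAl2025_thm12_rates` holds (`LeftAsm.leftData_of_hyp` on the window supplied by
`Shooting.window`, then `rates_of_leftData`).
[cite: CaolaboraEtAl2025, Thm 1.2, Rem. 1.5]
[cite: BuckmasterCaolaboraGomezserrano2025, Thm 1.1, Prop. 3.1, Props. 3.3, 3.5] -/
theorem rates_of_leftHyp (H : ∀ r ∈ Icc Shooting.rd Shooting.ru, LeftAsm.LeftHyp r) :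
    CaolaboraEtAl2025_thm12_rates :=
  rates_of_leftData fun r hr => by
    obtain ⟨h11, h28, h3, h4, -⟩ := Shooting.window hr
    exact LeftAsm.leftData_of_hyp h3 h4 h11 h28 (H r hr)

/-- **The rate-free instance `γ = 5/3` of CGSS Thm 1.2 / Rem. 1.5 from Proposition 3.1 on the
window** (via `thm12_euler_of_rates`). [cite: CaolaboraEtAl2025, Thm 1.2, Rem. 1.5]
[cite: BuckmasterCaolaboraGomezserrano2025, Thm 1.1, Prop. 3.1] -/
theorem thm12_euler_five_thirds_of_leftData
    (h : ∀ r ∈ Icc Shooting.rd Shooting.ru, LeftAsm.LeftData r) :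
    CaolaboraEtAl2025_thm12_euler (5 / 3) :=
  thm12_euler_of_rates (rates_of_leftData h)

/-- **The rate-free instance `γ = 5/3` of CGSS Thm 1.2 / Rem. 1.5 from the certified left-barrier
layer.** [cite: CaolaboraEtAl2025, Thm 1.2, Rem. 1.5]
[cite: BuckmasterCaolaboraGomezserrano2025, Thm 1.1, Props. 3.1, 3.3, 3.5] -/
theorem thm12_euler_five_thirds_of_leftHyp
    (H : ∀ r ∈ Icc Shooting.rd Shooting.ru, LeftAsm.LeftHyp r) :
    CaolaboraEtAl2025_thm12_euler (5 / 3) :=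
  thm12_euler_of_rates (rates_of_leftHyp H)

end CaolaboraEtAl2025

end Literature.Analysis.FluidPDE

end
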